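import Mathlib
import Literature.AlgebraicGeometry.Resolution.CobordantGame
import Summits.ResolutionOfSingularities.ResolutionOfSingularities.Theorems.WeightedInvariantLocalWeightedDropTwistedTrivialXOrder

/-!
# Twisted arcs of the kangaroo-type wild successor `bk1` (refuter evidence, crux `WeightedConstruction`)

[OURS · L1 W4.3 · refuter res-L1-w43-tri-1 (TRIAGER 1, lens KANGAROO-DISCHARGE), TRIAGE v9.5 §21.13 · supports
stmt-ResolutionOfSingularities-0571 · AI-written, weaker than expert review; nothing here is a statement about
resolution of singularities.]

The specimen `bk1` (characteristic 2): `F′ = X² + wA⁴ + w²b³`, weighted blow-up of `(X,A,b,w; 5,2,2,2)`, chart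
`w = s²(1+v)`; the strict transform is `g = X² + (1+v)A⁴ + (1+v)²b³`, its slice `v = 0` is
`h = X² + A⁴ + b³`, and the renormalised successor of idea-1's Sketch v5 §11c-5 (`g ∘ Λ₂`, `Λ₂` the wild frame
`Theorems.GradedGame.wildLambda (5,2,2,2) e_w 2`) is `G = (1+v)⁶X² + (1+v)⁵A⁴ + (1+v)⁵b³`.

With the tree predicate `Theorems.GradedGame.TwistedTrivialAlongFix` (twisted triviality along an arc `γ`, with an
ORIGIN-FIXING reparametrisation) we prove:

* `bk1_slice_twistedTrivialFix` — the slice `h` (variables `0 = s` idle, `1 = X, 2 = A, 3 = b`) is twisted-trivial of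
  exponent `2⁰` along the NON-GRADED arc `γ = (0, σ², σ, 0)` (`h(X+σ², A+σ, b) = h` in characteristic 2, `Φ = id`,
  `u = 1`); so both `X` and `A` are «saturated directions» of `h` in the sense of Sketch v5 `satDir`.
* `bk1_successor_arc_eq_zero` — for EVERY arc `γ` along which `G` (variables `0 = s, 1 = X, 2 = A, 3 = b, 4 = v`) is
  twisted-trivial (any exponent), `γ_X = γ_A = γ_b = 0`: the saturated directions of `G` are among `{s, v}`.
  Mechanism: by `Theorems.GradedGame.xOrderGE_of_twistedTrivialAlongFix` the translate `G(x + γ(σ))` has `x`-order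
  `≥ 2`, and its `x`-constant, `x_b`-linear and `x_v`-linear parts are `γ_X²c⁶ + (γ_A⁴+γ_b³)c⁵`, `3γ_b²c⁵` and
  `6γ_X²c⁵ + 5(γ_A⁴+γ_b³)c⁴` (`c = 1 + γ_v`, a unit).

Consequence (prose): idea-1's round-5 wild clause `Round5.SatDirTwistedCylinder` («`satDir p (g∘Λ_q) = {last} ∪
castSucc (satDir p h)`») fails at `bk1` — `X ∈ satDir 2 h` but `X ∉ satDir 2 (g∘Λ₂)` — while its round-6 repair C″
(credit only GRADED arcs of `h`) predicts `{s, v}`, consistent with `bk1_successor_arc_eq_zero`.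
-/

set_option linter.dupNamespace false -- mandated namespace of this single-conjunct summit
set_option autoImplicit false

namespace Summit.ResolutionOfSingularities.ResolutionOfSingularities.Theorems.WeightedConstruction.Negative.SatDirTwistedCylinderBk1

open MvPowerSeries
open Summit.ResolutionOfSingularities.ResolutionOfSingularities.Theorems.GradedGame

variable {k : Type} [Field k]

/-! ## The `σ`-embedding `k⟦σ⟧ → k⟦σ, x⟧` and its coefficients -/

/-- The embedding `γ ↦ γ(σ^(2^0))` used by `translateAlong 2 0` is substitutable. [OURS · L1 W4.3] -/
theorem hasSubst_sigma (N : ℕ) :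
    HasSubst (fun _ : Fin 1 => (X (0 : Fin (N + 1)) : MvPowerSeries (Fin (N + 1)) k) ^ (2 ^ 0)) :=
  hasSubst_of_constantCoeff_zero fun _ => by simp [constantCoeff_X]

/-- The monomials of `k⟦σ⟧` go to powers of `σ = X 0`. [OURS · L1 W4.3] -/
theorem prod_pow_sigma {N : ℕ} (d : Fin 1 →₀ ℕ) :
    (d.prod fun (_ : Fin 1) (e : ℕ) => ((X (0 : Fin (N + 1)) : MvPowerSeries (Fin (N + 1)) k) ^ (2 ^ 0)) ^ e) =
      (X (0 : Fin (N + 1)) : MvPowerSeries (Fin (N + 1)) k) ^ (d 0) := by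
  rw [Finsupp.prod_fintype _ _ (fun _ => by simp)]
  simp

/-- Pure-`σ` coefficients are preserved by the embedding. [OURS · L1 W4.3] -/
theorem coeff_single_subst_sigma {N : ℕ} (g : MvPowerSeries (Fin 1) k) (m : ℕ) :
    coeff (Finsupp.single (0 : Fin (N + 1)) m)
        (subst (fun _ : Fin 1 => (X (0 : Fin (N + 1)) : MvPowerSeries (Fin (N + 1)) k) ^ (2 ^ 0)) g) =
      coeff (Finsupp.single (0 : Fin 1) m) g := by
  classical
  rw [coeff_subst (hasSubst_sigma N), finsum_eq_single _ (Finsupp.single (0 : Fin 1) m)]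
  · rw [prod_pow_sigma, coeff_X_pow, if_pos (by simp), smul_eq_mul, mul_one]
  · intro d hd
    rw [prod_pow_sigma, coeff_X_pow, if_neg, smul_zero]
    intro h
    apply hd
    have hm : m = d 0 := Finsupp.single_injective _ h
    rw [Finsupp.unique_single d, hm]
    rfl

/-- A series of `k⟦σ⟧` all of whose coefficients vanish is zero (exponents of `Fin 1` are `single 0 m`). [OURS] -/
theorem eq_zero_of_coeff_single {g : MvPowerSeries (Fin 1) k} (h : ∀ m : ℕ, coeff (Finsupp.single (0 : Fin 1) m) g = 0) :
    g = 0 := by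
  ext d
  rw [Finsupp.unique_single d, map_zero]
  exact h (d default)

/-- Keep/kill after the translate: killing some `x`-variables (never `σ`) commutes past `translateAlong 2 0` onto the
substituted family. [OURS · L1 W4.3] -/
theorem subst_keep_translateAlong {n : ℕ} (P : Fin (n + 1) → Prop) [DecidablePred P] (hP : P 0)
    (γ : Fin n → MvPowerSeries (Fin 1) k) (hγ : ∀ i, constantCoeff (γ i) = 0) (f : MvPowerSeries (Fin n) k) :
    subst (fun v : Fin (n + 1) => if P v then (X v : MvPowerSeries (Fin (n + 1)) k) else 0) (translateAlong 2 0 f γ) =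
      subst (fun i : Fin n => (if P i.succ then (X i.succ : MvPowerSeries (Fin (n + 1)) k) else 0) +
        subst (fun _ : Fin 1 => (X (0 : Fin (n + 1)) : MvPowerSeries (Fin (n + 1)) k) ^ (2 ^ 0)) (γ i)) f := by
  classical
  have hK := hasSubst_keep (k := k) P
  have hT := hasSubst_translateFamily (k := k) (2 ^ 0) (by norm_num) γ hγ
  unfold translateAlong
  rw [subst_comp_subst_apply hT hK]
  congr 1
  funext i
  rw [subst_add hK, subst_X hK, subst_comp_subst_apply (hasSubst_sigma n) hK]
  congr 1
  congr 1
  funext s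
  rw [subst_pow hK, subst_X hK, if_pos hP]


/-- `(single 0 m) (succ i) = 0`. [OURS] -/
theorem single_zero_apply_succ {N : ℕ} (m : ℕ) (i : Fin N) :
    (Finsupp.single (0 : Fin (N + 1)) m) i.succ = 0 := by
  rw [Finsupp.single_apply, if_neg (Fin.succ_ne_zero i).symm]

/-- `(single (succ j) 1) (succ i) = [j = i]`. [OURS] -/
theorem single_succ_apply_succ {N : ℕ} (j i : Fin N) :
    (Finsupp.single j.succ 1 : Fin (N + 1) →₀ ℕ) i.succ = if j = i then 1 else 0 := by
  by_cases h : j = i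
  · subst h; simp
  · rw [if_neg h, Finsupp.single_apply, if_neg (fun e => h (Fin.succ_injective _ e))]

/-- The `x_j σ^m`-coefficient of `x_j · φ` is the `σ^m`-coefficient of `φ`. [OURS] -/
theorem coeff_single_add_X_mul {N : ℕ} (m : ℕ) (j : Fin (N + 1)) (φ : MvPowerSeries (Fin (N + 1)) k) :
    coeff (Finsupp.single (0 : Fin (N + 1)) m + Finsupp.single j 1) (X j * φ) = coeff (Finsupp.single 0 m) φ := by
  rw [X_def, coeff_monomial_mul, if_pos le_add_self, one_mul, add_tsub_cancel_right]

/-- `x_j² · φ` has no `x_j σ^m`-coefficient (`j ≠ 0`). [OURS] -/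
theorem coeff_single_add_X_sq_mul {N : ℕ} (m : ℕ) (j : Fin (N + 1)) (hj : j ≠ 0)
    (φ : MvPowerSeries (Fin (N + 1)) k) :
    coeff (Finsupp.single (0 : Fin (N + 1)) m + Finsupp.single j 1) (X j ^ 2 * φ) = 0 := by
  rw [X_pow_eq, coeff_monomial_mul, if_neg]
  intro h
  have h' := Finsupp.single_le_iff.mp h
  rw [Finsupp.add_apply, Finsupp.single_eq_same, Finsupp.single_apply, if_neg (fun e => hj e.symm)] at h'
  omega

/-! ## The slice `h = X² + A⁴ + b³` has the non-graded twisted arc `(0, σ², σ, 0)` -/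

/-- `bk1`, SLICE: `h = X² + A⁴ + b³` (char 2; `0 = s` idle, `1 = X`, `2 = A`, `3 = b`) is twisted-trivial of exponent
`2⁰` along `γ = (0, σ², σ, 0)`: `h(s, X+σ², A+σ, b) = X² + σ⁴ + A⁴ + σ⁴ + b³ = h`, so `Φ = id`, `u = 1`.  Hence `X`
(and `A`) lie in Sketch v5's `satDir 2 h`.  The arc is NOT graded (`X ↦ σ²`, `A ↦ σ` against the isotypic split
`X² | A⁴ + b³` of the successor), which is what C″ discards. [OURS · L1 W4.3 · tri-1 TRIAGE v9.5 §21.13 (i)] -/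
theorem bk1_slice_twistedTrivialFix [CharP k 2] :
    TwistedTrivialAlongFix 2 (X 1 ^ 2 + X 2 ^ 4 + X 3 ^ 3 : MvPowerSeries (Fin 4) k)
      (fun i => if i = 1 then X 0 ^ 2 else if i = 2 then X 0 else 0) := by
  classical
  haveI : CharP (MvPowerSeries (Fin (4 + 1)) k) 2 := charP_of_injective_ringHom C_injective 2
  have h2 : (2 : MvPowerSeries (Fin (4 + 1)) k) = 0 := CharP.ofNat_eq_zero _ 2
  set γ : Fin 4 → MvPowerSeries (Fin 1) k := fun i => if i = 1 then X 0 ^ 2 else if i = 2 then X 0 else 0 with hγ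
  have ha := hasSubst_sigma (k := k) 4
  have hK := hasSubst_keep (k := k) (fun v : Fin (4 + 1) => v = 0)
  have hKeq : (fun v : Fin (4 + 1) => if v = 0 then (X (0 : Fin (4 + 1)) : MvPowerSeries (Fin (4 + 1)) k) else 0) =
      fun v : Fin (4 + 1) => if v = 0 then (X v : MvPowerSeries (Fin (4 + 1)) k) else 0 := by
    funext v; by_cases hv : v = 0 <;> simp [hv]
  have hγ0 : ∀ i, constantCoeff (γ i) = 0 := fun i => by
    simp only [hγ]; split_ifs <;> simp [constantCoeff_X]
  -- the `σ`-images of the arc components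
  have hS : ∀ i, subst (fun _ : Fin 1 => (X (0 : Fin (4 + 1)) : MvPowerSeries (Fin (4 + 1)) k) ^ (2 ^ 0)) (γ i) =
      if i = 1 then X 0 ^ 2 else if i = 2 then X 0 else 0 := by
    intro i
    simp only [hγ]
    split_ifs
    · rw [subst_pow ha, subst_X ha]; simp
    · rw [subst_X ha]; simp
    · rw [← coe_substAlgHom ha, map_zero]
  refine ⟨hγ0, 0, fun j => X j.succ, 1, isUnit_one, fun j => constantCoeff_X _, fun j => ?_, ?_, ?_⟩
  · rw [hKeq, subst_X hK]
    simp [Fin.succ_ne_zero]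
  · have hM : (Matrix.of fun i j : Fin 4 =>
          coeff (Finsupp.single j.succ 1) (X i.succ : MvPowerSeries (Fin (4 + 1)) k)) = 1 := by
      ext i j
      rw [Matrix.of_apply, coeff_X, Matrix.one_apply]
      by_cases h : i = j
      · subst h; simp
      · rw [if_neg, if_neg h]
        intro h'
        exact h ((Fin.succ_injective _ ((Finsupp.single_left_inj one_ne_zero).mp h')).symm)
    rw [hM, Matrix.det_one]
    exact isUnit_one
  · have hT := hasSubst_translateFamily (k := k) (2 ^ 0) (by norm_num) γ hγ0
    have hI : HasSubst (fun j : Fin 4 => (X j.succ : MvPowerSeries (Fin (4 + 1)) k)) :=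
      hasSubst_of_constantCoeff_zero fun j => constantCoeff_X _
    rw [one_mul]
    rw [← coe_substAlgHom hT]
    simp only [← coe_substAlgHom hI, map_add, map_pow, substAlgHom_X, hS]
    simp only [Fin.isValue, Fin.reduceEq, ↓reduceIte]
    linear_combination (X 0 ^ 4 + X (Fin.succ (1 : Fin 4)) * X 0 ^ 2 + 2 * X (Fin.succ (2 : Fin 4)) ^ 3 * X 0
      + 3 * X (Fin.succ (2 : Fin 4)) ^ 2 * X 0 ^ 2 + 2 * X (Fin.succ (2 : Fin 4)) * X 0 ^ 3 :
        MvPowerSeries (Fin (4 + 1)) k) * h2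


/-! ## Every twisted arc of the successor `G = (1+v)⁶X² + (1+v)⁵A⁴ + (1+v)⁵b³` has `γ_X = γ_A = γ_b = 0` -/

/-- `bk1`, SUCCESSOR: if `G = X²(1+v)⁶ + A⁴(1+v)⁵ + b³(1+v)⁵` (char 2; `0 = s` idle, `1 = X`, `2 = A`, `3 = b`,
`4 = v`) is twisted-trivial along the arc `γ` (tree predicate, any Frobenius exponent), then `γ_X = γ_A = γ_b = 0`.
So Sketch v5's `satDir 2 G ⊆ {s, v}`: the direction `X ∈ satDir 2 h` of `bk1_slice_twistedTrivialFix` is NOT a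
saturated direction of `G = g ∘ Λ₂`, against `Round5.SatDirTwistedCylinder`; consistent with the repair C″.
[OURS · L1 W4.3 · tri-1 TRIAGE v9.5 §21.13 (ii)] -/
theorem bk1_successor_arc_eq_zero [CharP k 2] (γ : Fin 5 → MvPowerSeries (Fin 1) k)
    (hγ : TwistedTrivialAlongFix 2
      (X 1 ^ 2 * (1 + X 4) ^ 6 + X 2 ^ 4 * (1 + X 4) ^ 5 + X 3 ^ 3 * (1 + X 4) ^ 5 : MvPowerSeries (Fin 5) k) γ) :
    γ 1 = 0 ∧ γ 2 = 0 ∧ γ 3 = 0 := by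
  classical
  set G : MvPowerSeries (Fin 5) k :=
    X 1 ^ 2 * (1 + X 4) ^ 6 + X 2 ^ 4 * (1 + X 4) ^ 5 + X 3 ^ 3 * (1 + X 4) ^ 5 with hG
  have hγ0 : ∀ i, constantCoeff (γ i) = 0 := hγ.1
  -- characteristic 2 in `k⟦σ⟧`
  haveI : CharP (MvPowerSeries (Fin 1) k) 2 := charP_of_injective_ringHom C_injective 2
  have h2 : (2 : MvPowerSeries (Fin 1) k) = 0 := CharP.ofNat_eq_zero _ 2
  -- `G ∈ 𝔪²`
  have hO : OrderGE 2 G := by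
    intro m hm
    by_contra hlt
    push Not at hlt
    have h1 : m 1 < 2 := lt_of_le_of_lt
      (Finset.single_le_sum (f := fun i => m i) (fun i _ => Nat.zero_le _) (Finset.mem_univ (1 : Fin 5))) hlt
    have h2' : m 2 < 4 := lt_of_le_of_lt
      (Finset.single_le_sum (f := fun i => m i) (fun i _ => Nat.zero_le _) (Finset.mem_univ (2 : Fin 5))) (by omega)
    have h3 : m 3 < 3 := lt_of_le_of_lt
      (Finset.single_le_sum (f := fun i => m i) (fun i _ => Nat.zero_le _) (Finset.mem_univ (3 : Fin 5))) (by omega)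
    apply hm
    rw [hG, map_add, map_add, X_pow_eq (1 : Fin 5) 2, X_pow_eq (2 : Fin 5) 4, X_pow_eq (3 : Fin 5) 3,
      coeff_monomial_mul, coeff_monomial_mul, coeff_monomial_mul, if_neg, if_neg, if_neg, add_zero, add_zero]
    · exact fun h => absurd (Finsupp.single_le_iff.mp h) (by omega)
    · exact fun h => absurd (Finsupp.single_le_iff.mp h) (by omega)
    · exact fun h => absurd (Finsupp.single_le_iff.mp h) (by omega)
  -- the translate `G(x + γ(σ))` has `x`-order ≥ 2 (R4-1), so its coefficients of `x`-degree ≤ 1 vanish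
  have hX := xOrderGE_of_twistedTrivialAlongFix 2 two_ne_zero 2 G γ hO hγ 0
  have hcoef : ∀ μ : Fin (5 + 1) →₀ ℕ, (∑ i : Fin 5, μ i.succ) < 2 → coeff μ (translateAlong 2 0 G γ) = 0 := by
    intro μ hμ
    by_contra h
    have := hX μ h
    omega
  have ha := hasSubst_sigma (k := k) 5
  have haS0 : ∀ i, constantCoeff (subst (fun _ : Fin 1 => (X (0 : Fin (5 + 1)) : MvPowerSeries (Fin (5 + 1)) k)
      ^ (2 ^ 0)) (γ i)) = 0 := fun i =>
    constantCoeff_subst_eq_zero ha (fun _ => by simp [constantCoeff_X]) (hγ0 i)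
  -- STEP 0 (kill every `x`-variable): the `x`-constant part `q₀ = γ_X²c⁶ + γ_A⁴c⁵ + γ_b³c⁵` vanishes
  have hfam0 : (fun i : Fin 5 => (if (i.succ : Fin (5 + 1)) = 0 then (X i.succ : MvPowerSeries (Fin (5 + 1)) k) else 0)
      + subst (fun _ : Fin 1 => (X (0 : Fin (5 + 1)) : MvPowerSeries (Fin (5 + 1)) k) ^ (2 ^ 0)) (γ i)) =
      fun i : Fin 5 => subst (fun _ : Fin 1 => (X (0 : Fin (5 + 1)) : MvPowerSeries (Fin (5 + 1)) k) ^ (2 ^ 0))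
        (γ i) := by
    funext i
    rw [if_neg (Fin.succ_ne_zero i), zero_add]
  have hT0 : HasSubst (fun i : Fin 5 => subst (fun _ : Fin 1 => (X (0 : Fin (5 + 1)) : MvPowerSeries (Fin (5 + 1)) k)
      ^ (2 ^ 0)) (γ i)) := hasSubst_of_constantCoeff_zero haS0
  have hE0 : subst (fun v : Fin (5 + 1) => if v = 0 then (X v : MvPowerSeries (Fin (5 + 1)) k) else 0)
        (translateAlong 2 0 G γ) =
      subst (fun _ : Fin 1 => (X (0 : Fin (5 + 1)) : MvPowerSeries (Fin (5 + 1)) k) ^ (2 ^ 0))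
        (γ 1 ^ 2 * (1 + γ 4) ^ 6 + γ 2 ^ 4 * (1 + γ 4) ^ 5 + γ 3 ^ 3 * (1 + γ 4) ^ 5) := by
    rw [subst_keep_translateAlong (fun v : Fin (5 + 1) => v = 0) rfl γ hγ0 G, hfam0, hG, ← coe_substAlgHom hT0]
    simp only [map_add, map_mul, map_pow, map_one, substAlgHom_X]
    conv_rhs => rw [← coe_substAlgHom ha]; simp only [map_add, map_mul, map_pow, map_one]
    rw [coe_substAlgHom ha]
  have hq0 : γ 1 ^ 2 * (1 + γ 4) ^ 6 + γ 2 ^ 4 * (1 + γ 4) ^ 5 + γ 3 ^ 3 * (1 + γ 4) ^ 5 = 0 := by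
    apply eq_zero_of_coeff_single
    intro m
    rw [← coeff_single_subst_sigma (N := 5), ← hE0,
      coeff_subst_keep _ _ _ (fun v hv => by
        by_contra h
        exact hv (by rw [Finsupp.single_apply, if_neg (Ne.symm h)])),
      hcoef _ (by simp only [single_zero_apply_succ, Finset.sum_const_zero]; norm_num)]
  have hq0' : subst (fun _ : Fin 1 => (X (0 : Fin (5 + 1)) : MvPowerSeries (Fin (5 + 1)) k) ^ (2 ^ 0))
      (γ 1 ^ 2 * (1 + γ 4) ^ 6 + γ 2 ^ 4 * (1 + γ 4) ^ 5 + γ 3 ^ 3 * (1 + γ 4) ^ 5) = 0 := by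
    rw [hq0, ← coe_substAlgHom ha, map_zero]
  -- STEP b (keep `σ` and `x_b = X (succ 3)`): the `x_b`-linear part `3γ_b²c⁵` of the translate vanishes
  have hfamb : (fun i : Fin 5 => (if ((i.succ : Fin (5 + 1)) = 0 ∨ (i.succ : Fin (5 + 1)) = Fin.succ 3)
        then (X i.succ : MvPowerSeries (Fin (5 + 1)) k) else 0) + subst (fun _ : Fin 1 => (X (0 : Fin (5 + 1)) : MvPowerSeries (Fin (5 + 1)) k) ^ (2 ^ 0)) (γ i)) =
      fun i : Fin 5 => (if i = 3 then (X i.succ : MvPowerSeries (Fin (5 + 1)) k) else 0) + subst (fun _ : Fin 1 => (X (0 : Fin (5 + 1)) : MvPowerSeries (Fin (5 + 1)) k) ^ (2 ^ 0)) (γ i) := by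
    funext i
    by_cases hi : i = 3
    · subst hi; simp
    · rw [if_neg, if_neg hi]
      rintro (h | h)
      · exact Fin.succ_ne_zero _ h
      · exact hi (Fin.succ_injective _ h)
  have hTb : HasSubst (fun i : Fin 5 => (if i = 3 then (X i.succ : MvPowerSeries (Fin (5 + 1)) k) else 0)
      + subst (fun _ : Fin 1 => (X (0 : Fin (5 + 1)) : MvPowerSeries (Fin (5 + 1)) k) ^ (2 ^ 0)) (γ i)) :=
    hasSubst_of_constantCoeff_zero fun i => by
      rw [map_add, haS0 i, add_zero]
      split_ifs <;> simp [constantCoeff_X]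
  have hEb : subst (fun v : Fin (5 + 1) => if (v = 0 ∨ v = Fin.succ 3) then (X v : MvPowerSeries (Fin (5 + 1)) k) else 0)
        (translateAlong 2 0 G γ) =
      X (Fin.succ 3) * subst (fun _ : Fin 1 => (X (0 : Fin (5 + 1)) : MvPowerSeries (Fin (5 + 1)) k) ^ (2 ^ 0)) (3 * γ 3 ^ 2 * (1 + γ 4) ^ 5)
      + X (Fin.succ 3) ^ 2 * (3 * subst (fun _ : Fin 1 => (X (0 : Fin (5 + 1)) : MvPowerSeries (Fin (5 + 1)) k) ^ (2 ^ 0)) (γ 3) * (1 + subst (fun _ : Fin 1 => (X (0 : Fin (5 + 1)) : MvPowerSeries (Fin (5 + 1)) k) ^ (2 ^ 0)) (γ 4)) ^ 5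
          + X (Fin.succ 3) * (1 + subst (fun _ : Fin 1 => (X (0 : Fin (5 + 1)) : MvPowerSeries (Fin (5 + 1)) k) ^ (2 ^ 0)) (γ 4)) ^ 5)
      + subst (fun _ : Fin 1 => (X (0 : Fin (5 + 1)) : MvPowerSeries (Fin (5 + 1)) k) ^ (2 ^ 0))
          (γ 1 ^ 2 * (1 + γ 4) ^ 6 + γ 2 ^ 4 * (1 + γ 4) ^ 5 + γ 3 ^ 3 * (1 + γ 4) ^ 5) := by
    rw [subst_keep_translateAlong (fun v : Fin (5 + 1) => v = 0 ∨ v = Fin.succ 3) (Or.inl rfl) γ hγ0 G, hfamb, hG,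
      ← coe_substAlgHom hTb]
    simp only [map_add, map_mul, map_pow, map_one]
    rw [substAlgHom_X, substAlgHom_X, substAlgHom_X, substAlgHom_X]
    rw [if_neg (show ¬((1 : Fin 5) = 3) by decide), if_neg (show ¬((2 : Fin 5) = 3) by decide),
      if_pos (show ((3 : Fin 5) = 3) from rfl), if_neg (show ¬((4 : Fin 5) = 3) by decide), zero_add, zero_add,
      zero_add]
    conv_rhs => rw [← coe_substAlgHom ha]; simp only [map_add, map_mul, map_pow, map_one, map_ofNat]
    rw [coe_substAlgHom ha]
    ring
  have hrb : (3 * γ 3 ^ 2 * (1 + γ 4) ^ 5 : MvPowerSeries (Fin 1) k) = 0 := by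
    apply eq_zero_of_coeff_single
    intro m
    have hc := hcoef (Finsupp.single 0 m + Finsupp.single (Fin.succ 3) 1) (by
      simp only [Finsupp.add_apply, single_zero_apply_succ, single_succ_apply_succ, zero_add, Finset.sum_ite_eq,
        Finset.mem_univ, if_true]
      norm_num)
    rw [← coeff_subst_keep (fun v : Fin (5 + 1) => v = 0 ∨ v = Fin.succ 3) _ _ (fun v hv => by
        by_contra h
        push Not at h
        apply hv
        rw [Finsupp.add_apply, Finsupp.single_apply, if_neg (Ne.symm h.1), Finsupp.single_apply,
          if_neg (Ne.symm h.2), add_zero]),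
      hEb, hq0', add_zero, map_add, coeff_single_add_X_mul, coeff_single_add_X_sq_mul _ _ (Fin.succ_ne_zero 3),
      add_zero, coeff_single_subst_sigma (N := 5)] at hc
    exact hc
  -- STEP v (keep `σ` and `x_v = X (succ 4)`): the `x_v`-linear part `6γ_X²c⁵ + 5(γ_A⁴+γ_b³)c⁴` vanishes
  have hfamv : (fun i : Fin 5 => (if ((i.succ : Fin (5 + 1)) = 0 ∨ (i.succ : Fin (5 + 1)) = Fin.succ 4)
        then (X i.succ : MvPowerSeries (Fin (5 + 1)) k) else 0) + subst (fun _ : Fin 1 => (X (0 : Fin (5 + 1)) : MvPowerSeries (Fin (5 + 1)) k) ^ (2 ^ 0)) (γ i)) =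
      fun i : Fin 5 => (if i = 4 then (X i.succ : MvPowerSeries (Fin (5 + 1)) k) else 0) + subst (fun _ : Fin 1 => (X (0 : Fin (5 + 1)) : MvPowerSeries (Fin (5 + 1)) k) ^ (2 ^ 0)) (γ i) := by
    funext i
    by_cases hi : i = 4
    · subst hi; simp
    · rw [if_neg, if_neg hi]
      rintro (h | h)
      · exact Fin.succ_ne_zero _ h
      · exact hi (Fin.succ_injective _ h)
  have hTv : HasSubst (fun i : Fin 5 => (if i = 4 then (X i.succ : MvPowerSeries (Fin (5 + 1)) k) else 0)
      + subst (fun _ : Fin 1 => (X (0 : Fin (5 + 1)) : MvPowerSeries (Fin (5 + 1)) k) ^ (2 ^ 0)) (γ i)) :=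
    hasSubst_of_constantCoeff_zero fun i => by
      rw [map_add, haS0 i, add_zero]
      split_ifs <;> simp [constantCoeff_X]
  have hEv : subst (fun v : Fin (5 + 1) => if (v = 0 ∨ v = Fin.succ 4) then (X v : MvPowerSeries (Fin (5 + 1)) k) else 0)
        (translateAlong 2 0 G γ) =
      X (Fin.succ 4) * subst (fun _ : Fin 1 => (X (0 : Fin (5 + 1)) : MvPowerSeries (Fin (5 + 1)) k) ^ (2 ^ 0))
          (6 * γ 1 ^ 2 * (1 + γ 4) ^ 5 + 5 * (γ 2 ^ 4 + γ 3 ^ 3) * (1 + γ 4) ^ 4)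
      + X (Fin.succ 4) ^ 2 *
          (subst (fun _ : Fin 1 => (X (0 : Fin (5 + 1)) : MvPowerSeries (Fin (5 + 1)) k) ^ (2 ^ 0)) (γ 1) ^ 2 *
              (15 * (1 + subst (fun _ : Fin 1 => (X (0 : Fin (5 + 1)) : MvPowerSeries (Fin (5 + 1)) k) ^ (2 ^ 0)) (γ 4)) ^ 4
                + 20 * (1 + subst (fun _ : Fin 1 => (X (0 : Fin (5 + 1)) : MvPowerSeries (Fin (5 + 1)) k) ^ (2 ^ 0)) (γ 4)) ^ 3 * X (Fin.succ 4)
                + 15 * (1 + subst (fun _ : Fin 1 => (X (0 : Fin (5 + 1)) : MvPowerSeries (Fin (5 + 1)) k) ^ (2 ^ 0)) (γ 4)) ^ 2 * X (Fin.succ 4) ^ 2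
                + 6 * (1 + subst (fun _ : Fin 1 => (X (0 : Fin (5 + 1)) : MvPowerSeries (Fin (5 + 1)) k) ^ (2 ^ 0)) (γ 4)) * X (Fin.succ 4) ^ 3 + X (Fin.succ 4) ^ 4)
            + (subst (fun _ : Fin 1 => (X (0 : Fin (5 + 1)) : MvPowerSeries (Fin (5 + 1)) k) ^ (2 ^ 0)) (γ 2) ^ 4 + subst (fun _ : Fin 1 => (X (0 : Fin (5 + 1)) : MvPowerSeries (Fin (5 + 1)) k) ^ (2 ^ 0)) (γ 3) ^ 3) *
              (10 * (1 + subst (fun _ : Fin 1 => (X (0 : Fin (5 + 1)) : MvPowerSeries (Fin (5 + 1)) k) ^ (2 ^ 0)) (γ 4)) ^ 3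
                + 10 * (1 + subst (fun _ : Fin 1 => (X (0 : Fin (5 + 1)) : MvPowerSeries (Fin (5 + 1)) k) ^ (2 ^ 0)) (γ 4)) ^ 2 * X (Fin.succ 4)
                + 5 * (1 + subst (fun _ : Fin 1 => (X (0 : Fin (5 + 1)) : MvPowerSeries (Fin (5 + 1)) k) ^ (2 ^ 0)) (γ 4)) * X (Fin.succ 4) ^ 2 + X (Fin.succ 4) ^ 3))
      + subst (fun _ : Fin 1 => (X (0 : Fin (5 + 1)) : MvPowerSeries (Fin (5 + 1)) k) ^ (2 ^ 0))
          (γ 1 ^ 2 * (1 + γ 4) ^ 6 + γ 2 ^ 4 * (1 + γ 4) ^ 5 + γ 3 ^ 3 * (1 + γ 4) ^ 5) := by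
    rw [subst_keep_translateAlong (fun v : Fin (5 + 1) => v = 0 ∨ v = Fin.succ 4) (Or.inl rfl) γ hγ0 G, hfamv, hG,
      ← coe_substAlgHom hTv]
    simp only [map_add, map_mul, map_pow, map_one]
    rw [substAlgHom_X, substAlgHom_X, substAlgHom_X, substAlgHom_X]
    rw [if_neg (show ¬((1 : Fin 5) = 4) by decide), if_neg (show ¬((2 : Fin 5) = 4) by decide),
      if_neg (show ¬((3 : Fin 5) = 4) by decide), if_pos (show ((4 : Fin 5) = 4) from rfl), zero_add, zero_add,
      zero_add]
    conv_rhs => rw [← coe_substAlgHom ha]; simp only [map_add, map_mul, map_pow, map_one, map_ofNat]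
    rw [coe_substAlgHom ha]
    ring
  have hrv : (6 * γ 1 ^ 2 * (1 + γ 4) ^ 5 + 5 * (γ 2 ^ 4 + γ 3 ^ 3) * (1 + γ 4) ^ 4 : MvPowerSeries (Fin 1) k) = 0 := by
    apply eq_zero_of_coeff_single
    intro m
    have hc := hcoef (Finsupp.single 0 m + Finsupp.single (Fin.succ 4) 1) (by
      simp only [Finsupp.add_apply, single_zero_apply_succ, single_succ_apply_succ, zero_add, Finset.sum_ite_eq,
        Finset.mem_univ, if_true]
      norm_num)
    rw [← coeff_subst_keep (fun v : Fin (5 + 1) => v = 0 ∨ v = Fin.succ 4) _ _ (fun v hv => by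
        by_contra h
        push Not at h
        apply hv
        rw [Finsupp.add_apply, Finsupp.single_apply, if_neg (Ne.symm h.1), Finsupp.single_apply,
          if_neg (Ne.symm h.2), add_zero]),
      hEv, hq0', add_zero, map_add, coeff_single_add_X_mul, coeff_single_add_X_sq_mul _ _ (Fin.succ_ne_zero 4),
      add_zero, coeff_single_subst_sigma (N := 5)] at hc
    exact hc
  -- CONCLUSION in `k⟦σ⟧` (char 2, `1 + γ_v` a unit, no zero divisors)
  have h14 : (1 + γ 4 : MvPowerSeries (Fin 1) k) ≠ 0 := fun h => by
    have h' := congrArg constantCoeff h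
    rw [map_add, map_one, hγ0 4, add_zero, map_zero] at h'
    exact one_ne_zero h'
  have hγ3 : γ 3 = 0 := by
    have e : γ 3 ^ 2 * (1 + γ 4) ^ 5 = 0 := by
      linear_combination hrb - (γ 3 ^ 2 * (1 + γ 4) ^ 5) * h2
    rcases mul_eq_zero.mp e with h | h
    · exact (pow_eq_zero_iff two_ne_zero).mp h
    · exact absurd ((pow_eq_zero_iff (by norm_num)).mp h) h14
  have hγ2 : γ 2 = 0 := by
    have e : γ 2 ^ 4 * (1 + γ 4) ^ 4 = 0 := by
      rw [hγ3] at hrv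
      linear_combination hrv + (-3 * γ 1 ^ 2 * (1 + γ 4) ^ 5 - 2 * γ 2 ^ 4 * (1 + γ 4) ^ 4) * h2
    rcases mul_eq_zero.mp e with h | h
    · exact (pow_eq_zero_iff (by norm_num)).mp h
    · exact absurd ((pow_eq_zero_iff (by norm_num)).mp h) h14
  have hγ1 : γ 1 = 0 := by
    have e : γ 1 ^ 2 * (1 + γ 4) ^ 6 = 0 := by
      rw [hγ2, hγ3] at hq0
      linear_combination hq0
    rcases mul_eq_zero.mp e with h | h
    · exact (pow_eq_zero_iff two_ne_zero).mp h
    · exact absurd ((pow_eq_zero_iff (by norm_num)).mp h) h14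
  exact ⟨hγ1, hγ2, hγ3⟩

end Summit.ResolutionOfSingularities.ResolutionOfSingularities.Theorems.WeightedConstruction.Negative.SatDirTwistedCylinderBk1
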